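import Literature.IUT.HodgeArakelov.IotaInvariantThetaInftyModel
import Literature.AnabelianGeometry.EtaleTheta.CyclotomeGaloisFixedPoints

/-!
# [IUTchII] Prop 1.4 / Cor 1.12 (c) / Prop 2.2 (ii) at the model `Π = Π^tp_X̲̲`: the «cyclotomic
# no-invariants» hypothesis `hfix` follows from «`Δ_Θ ≅ Ẑ(1)` as a `G_K`-module»

S. Mochizuki, *Inter-universal Teichmüller theory II*, Prop. 1.4 p. 27 / Cor. 1.12 (c) p. 56 /
Prop. 2.2 (ii) p. 66 (kurims manuscript), typed AT THE MODEL `D := etaleThetaDataOfSetting'`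
(abc-iut-L6-t1, `EtaleThetaDataOfSetting.lean`) over the [EtTh] §1–§2 data
`D : ThetaSetting p`, `E : D.EtaleThetaData`, `C : E.DoubleUnderline l`.  Three landed model theorems —
`h1LimRestrict_injective_of_forall_fixed_eq_one` (`CohomologyLimitRestrictionInjective.lean`),
`toLim_top_injective_of_forall_fixed_eq_one`, `inftyClause_uniqueness_etaleThetaDataOfSetting'`,
`inftyClause_etaleThetaDataOfSetting'` (`IotaInvariantThetaInftyModel.lean`) — carry the hypothesis

  `hfix : ∀ K' ≤ Π^tp_X̲̲` of finite index, `∀ a ∈ l·Δ_Θ`,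
          `(∀ n ∈ Π^tp_Ÿ̲̲ ∩ K', φ(n) a φ(n)⁻¹ = a) → a = 1`

(«no element `≠ 1` of `(l·Δ_Θ)(Π)` is fixed by `Π_Ÿ(Π) ∩ K'`»).  The [EtTh] §1 root interface
`ThetaSetting` (v3) records `Δ_Θ` only as the central kernel of `(Π^tp_X)^Θ ↠ (Π^tp_X)^ell`; its module
docstring lists "`Δ_Θ ≅ Ẑ(1)` … as `G_K`-modules (the Tate twist)" ([EtTh] §1 p. 12 = PRIMS p. 238) among
the DEFERRED TRANSCRIPTIONS.  THIS FILE proves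

  **`hfix` ⟸ (`Δ_Θ`, with the conjugation action of `Π^tp_X` through `Π^tp_X ↠ (Π^tp_X)^Θ`, is a Tate
  twist `Ẑ(1) = lim_n μ_n(ℚ̄_p)` for `G_K` acting through `aug`)**

(`forall_conj_fixed_eq_one_of_tateTwist`, binder form `hfix_of_tateTwist`; corollaries
`toLim_top_injective_of_tateTwist`, `inftyClause_uniqueness_of_tateTwist`, `inftyClause_of_tateTwist` =
the three consumers with `hfix` discharged), the Tate-twist datum being taken LEVEL-WISE exactly as in the
tree's group-level predicate `SemiGraphs.OncePuncturedTemperedGroup.IsTateTwist` ([EtTh] §1 p. 238;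
named fact `DeltaThetaIsoTate`, FACT-LIST F-0658): maps `ι_n : Δ_Θ → μ_n(ℚ̄_p)` (`n ≥ 1`), compatible
(`ι_{nm}^m = ι_n`), jointly injective, and `aug`-equivariant.  Ingredients: `aug(Π^tp_Ÿ̲̲) = G_K`
(`DoubleUnderline.map_aug_Ydduu`, [EtTh] Prop 2.2 (iii)), so `aug(Π^tp_Ÿ̲̲ ∩ K')` has finite index in the
open subgroup `G_K ≤ G_{ℚ_p}`; and `Ẑ(1)^U = 1` for such `U`
(`padicAlgCl_compatibleRoots_eq_one_of_finiteIndex_in_fixingSubgroup`, `CyclotomeGaloisFixedPoints.lean`,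
classical: a `p`-adic field has finitely many roots of unity).

Proof-only (no definitions, no named facts).  The Tate-twist datum enters as explicit binders (it is the
curve-level transcription the root interface defers; the cell's GAP-LEDGER row G-w4d041-1 asks for it as a
field of `ThetaSetting`, or via the bridge `ThetaSetting.toOncePuncturedTemperedGroup` from F-0658).
[EtTh] is refereed; the [IUTchII] claim key is `Mochizuki2012` (disputed); nothing here bears on [IUTchIII]
Cor. 3.12; typed ≠ proved.
-/

noncomputable section

namespace Literature.IUT.HodgeArakelov

namespace EtaleThetaDataOfSetting

open Literature.AnabelianGeometry.EtaleTheta Literature.AnabelianGeometry.SemiGraphs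

variable {p : ℕ} [Fact p.Prime] {D : Literature.AnabelianGeometry.EtaleTheta.ThetaSetting p}
  {E : D.EtaleThetaData} {l : ℕ} (C : E.DoubleUnderline l)

/-- Finite relative index is preserved by taking images: if `H ≤ P` with `[P : H] < ∞` then
`[f(P) : f(H)] < ∞` (the restriction `P ↠ f(P)` maps `H` onto `f(H)`). [folklore] -/
private theorem finiteIndex_subgroupOf_map {G G' : Type*} [Group G] [Group G'] (f : G →* G')
    (H P : Subgroup G) (hHP : H ≤ P) [hfin : (H.subgroupOf P).FiniteIndex] :
    ((H.map f).subgroupOf (P.map f)).FiniteIndex := by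
  have hsurj : Function.Surjective (f.subgroupMap P) := f.subgroupMap_surjective P
  have heq : (H.subgroupOf P).map (f.subgroupMap P) = (H.map f).subgroupOf (P.map f) := by
    ext ⟨y, hy⟩
    simp only [Subgroup.mem_map, Subgroup.mem_subgroupOf]
    constructor
    · rintro ⟨⟨x, hxP⟩, hxH, hxy⟩
      exact ⟨x, hxH, congrArg Subtype.val hxy⟩
    · rintro ⟨x, hxH, hxy⟩
      exact ⟨⟨x, hHP hxH⟩, hxH, Subtype.ext hxy⟩
  refine ⟨fun h0 => hfin.index_ne_zero ?_⟩
  have hdvd := Subgroup.index_map_dvd (H.subgroupOf P) hsurj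
  rw [heq, h0] at hdvd
  exact Nat.eq_zero_of_zero_dvd hdvd

/-- **`aug(Π^tp_Ÿ̲̲) = G_K`** for `Π_Ÿ(Π) = Π^tp_Ÿ̲̲ ⊆ Π = Π^tp_X̲̲` (abc-iut-L2-t8's
`DoubleUnderline.map_aug_Ydduu`, read through `Π^tp_X̲̲ ↪ Π^tp_X`). [cite: MochizukiEtTh2009, Prop 2.2 (iii) p.37] -/
theorem map_aug_PiYdd :
    (PiYdd C).map (D.aug.toMonoidHom.comp C.Huu.subtype) = D.GK := by
  rw [← Subgroup.map_map, Subgroup.subgroupOf_map_subtype, inf_eq_left.mpr inf_le_right]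
  exact C.map_aug_Ydduu

/-- **The «cyclotomic no-invariants» hypothesis `hfix` at the model follows from the Tate twist
`Δ_Θ ≅ Ẑ(1)`** ([EtTh] §1 p. 12 / PRIMS p. 238 "`(Ẑ(1) ≅) Δ_Θ`"; [IUTchII] Prop 1.4 p. 27 "`J` ranges
over the finite index open subgroups of `Π`"): given LEVEL MAPS `ι_n : Δ_Θ → μ_n(ℚ̄_p)` (`n ≥ 1`) that are
compatible (`ι_{nm}(t)^m = ι_n(t)`), jointly injective, and equivariant for `Π^tp_X` acting on
`Δ_Θ ⊆ (Π^tp_X)^Θ` by conjugation through `Π^tp_X ↠ (Π^tp_X)^Θ` and on `μ_n(ℚ̄_p)` through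
`aug : Π^tp_X → G_{ℚ_p}` — the shape of `SemiGraphs.OncePuncturedTemperedGroup.IsTateTwist` /
`DeltaThetaIsoTate` — every element of `l·Δ_Θ` fixed by `Π^tp_Ÿ̲̲ ∩ K'`, `K' ≤ Π^tp_X̲̲` of finite index,
is trivial.  Proof: `aug(Π^tp_Ÿ̲̲ ∩ K')` has finite index in the open subgroup `G_K = aug(Π^tp_Ÿ̲̲)`
(`map_aug_PiYdd`); the `ι_n` of a fixed element form a compatible family of roots of unity of `ℚ̄_p` fixed
by it, trivial by `padicAlgCl_compatibleRoots_eq_one_of_finiteIndex_in_fixingSubgroup`; joint injectivity.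
This DISCHARGES the binder `hfix` of `h1LimRestrict_injective_of_forall_fixed_eq_one` /
`toLim_top_injective_of_forall_fixed_eq_one` / `inftyClause_(uniqueness_)etaleThetaDataOfSetting'` modulo
the Tate-twist datum. [cite: MochizukiEtTh2009, §1 p.238] -/
theorem forall_conj_fixed_eq_one_of_tateTwist
    (ι : ℕ → (↥D.DeltaTheta →* (PadicAlgCl p)ˣ))
    (hpow : ∀ n, 0 < n → ∀ t : ↥D.DeltaTheta, (ι n t) ^ n = 1)
    (hcompat : ∀ n m, 0 < n → 0 < m → ∀ t : ↥D.DeltaTheta, (ι (n * m) t) ^ m = ι n t)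
    (hinj : ∀ t : ↥D.DeltaTheta, (∀ n, 0 < n → ι n t = 1) → t = 1)
    (hequiv : ∀ n, 0 < n → ∀ (g : D.PiTemp) (t : ↥D.DeltaTheta),
      ((ι n (MulAut.conjNormal (D.toTheta g) t) : (PadicAlgCl p)ˣ) : PadicAlgCl p) =
        (D.aug g) ((ι n t : (PadicAlgCl p)ˣ) : PadicAlgCl p))
    (K' : Subgroup (Pi C)) [K'.FiniteIndex] (a : ↥(D.lDeltaTheta l))
    (ha : ∀ n : Pi C, n ∈ PiYdd C ⊓ K' → MulAut.conjNormal (phi C n) a = a) : a = 1 := by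
  classical
  haveI : FiniteDimensional ℚ_[p] D.K := D.finiteDimensional_K
  -- the element of `Δ_Θ` under `a ∈ l·Δ_Θ ⊆ Δ_Θ`
  set t : ↥D.DeltaTheta := ⟨(a : D.GtpTheta), D.lDeltaTheta_le l a.2⟩ with htdef
  -- `U := aug(Π^tp_Ÿ̲̲ ∩ K') ≤ G_{ℚ_p}` has finite index in the open subgroup `G_K`
  set f : (Pi C) →* GQp p := D.aug.toMonoidHom.comp C.Huu.subtype with hfdef
  set U : Subgroup (GQp p) := (PiYdd C ⊓ K').map f with hUdef
  haveI : ((PiYdd C ⊓ K').subgroupOf (PiYdd C)).FiniteIndex := by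
    rw [Subgroup.inf_subgroupOf_left]
    infer_instance
  haveI : (U.subgroupOf D.K.fixingSubgroup).FiniteIndex := by
    have h := finiteIndex_subgroupOf_map f (PiYdd C ⊓ K') (PiYdd C) inf_le_left
    rw [map_aug_PiYdd] at h
    exact h
  -- the compatible family of roots of unity `ζ_n := ι_n(t)` in `ℚ̄_p`
  set ζ : ℕ → PadicAlgCl p := fun n => ((ι n t : (PadicAlgCl p)ˣ) : PadicAlgCl p) with hζ
  have hζcompat : ∀ n m : ℕ, 0 < n → 0 < m → ζ (n * m) ^ m = ζ n := by
    intro n m hn hm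
    simp only [hζ, ← Units.val_pow_eq_pow_val, hcompat n m hn hm t]
  have hζtor : ∀ n, 0 < n → ζ n ^ n = 1 := by
    intro n hn
    simp only [hζ, ← Units.val_pow_eq_pow_val, hpow n hn t, Units.val_one]
  -- `ζ` is fixed by `U`: a fixed `a` gives fixed `ι_n(t)` by equivariance
  have hζfix : ∀ σ ∈ U, ∀ n, 0 < n → σ (ζ n) = ζ n := by
    intro σ hσ n hn
    rw [hUdef] at hσ
    obtain ⟨g, hg, rfl⟩ := Subgroup.mem_map.mp hσ
    have hconj : MulAut.conjNormal (D.toTheta (g : D.PiTemp)) t = t := by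
      apply Subtype.ext
      rw [MulAut.conjNormal_apply]
      have h : ((MulAut.conjNormal (phi C g) a : ↥(D.lDeltaTheta l)) : D.GtpTheta) =
          (a : D.GtpTheta) := congrArg Subtype.val (ha g hg)
      rw [MulAut.conjNormal_apply] at h
      exact h
    have h := hequiv n hn (g : D.PiTemp) t
    rw [hconj] at h
    change (D.aug (g : D.PiTemp)) (ζ n) = ζ n
    exact h.symm
  have hζone := padicAlgCl_compatibleRoots_eq_one_of_finiteIndex_in_fixingSubgroup p D.K U ζ
    hζcompat hζtor hζfix
  have ht1 : t = 1 := hinj t fun n hn => Units.val_eq_one.mp (hζone n hn)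
  exact Subtype.ext (congrArg (fun x : ↥D.DeltaTheta => (x : D.GtpTheta)) ht1)

/-- **`hfix` from the Tate twist**, in the exact binder shape of the consumers
(`∀ K'` of finite index, `∀ a ∈ l·Δ_Θ` fixed by `Π^tp_Ÿ̲̲ ∩ K'`, `a = 1`). [cite: MochizukiEtTh2009, §1 p.238] -/
theorem hfix_of_tateTwist
    (ι : ℕ → (↥D.DeltaTheta →* (PadicAlgCl p)ˣ))
    (hpow : ∀ n, 0 < n → ∀ t : ↥D.DeltaTheta, (ι n t) ^ n = 1)
    (hcompat : ∀ n m, 0 < n → 0 < m → ∀ t : ↥D.DeltaTheta, (ι (n * m) t) ^ m = ι n t)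
    (hinj : ∀ t : ↥D.DeltaTheta, (∀ n, 0 < n → ι n t = 1) → t = 1)
    (hequiv : ∀ n, 0 < n → ∀ (g : D.PiTemp) (t : ↥D.DeltaTheta),
      ((ι n (MulAut.conjNormal (D.toTheta g) t) : (PadicAlgCl p)ˣ) : PadicAlgCl p) =
        (D.aug g) ((ι n t : (PadicAlgCl p)ˣ) : PadicAlgCl p)) :
    ∀ K' : Subgroup (Pi C), K'.FiniteIndex → ∀ a : ↥(D.lDeltaTheta l),
      (∀ n : Pi C, n ∈ PiYdd C ⊓ K' → MulAut.conjNormal (phi C n) a = a) → a = 1 :=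
  fun K' hK' a ha => by
    haveI := hK'
    exact forall_conj_fixed_eq_one_of_tateTwist C ι hpow hcompat hinj hequiv K' a ha

/-- **[IUTchII] Cor 1.12 (c) / Prop 1.4 at the model, modulo the Tate twist**: the canonical map
`H¹(Π^tp_Ÿ̲̲, l·Δ_Θ) → lim_J H¹(Π^tp_Ÿ̲̲ ∩ J, l·Δ_Θ)` (`(coh C).toLim ⊤`) is INJECTIVE — abc-iut-w5-d187's
`toLim_top_injective_of_forall_fixed_eq_one` with its hypothesis `hfix` DISCHARGED from the Tate-twist
datum. [claim: Mochizuki2012, status: disputed] (IUTchII Cor 1.12 (c) p.56 "natural inclusion") -/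
theorem toLim_top_injective_of_tateTwist
    (ι : ℕ → (↥D.DeltaTheta →* (PadicAlgCl p)ˣ))
    (hpow : ∀ n, 0 < n → ∀ t : ↥D.DeltaTheta, (ι n t) ^ n = 1)
    (hcompat : ∀ n m, 0 < n → 0 < m → ∀ t : ↥D.DeltaTheta, (ι (n * m) t) ^ m = ι n t)
    (hinj : ∀ t : ↥D.DeltaTheta, (∀ n, 0 < n → ι n t = 1) → t = 1)
    (hequiv : ∀ n, 0 < n → ∀ (g : D.PiTemp) (t : ↥D.DeltaTheta),
      ((ι n (MulAut.conjNormal (D.toTheta g) t) : (PadicAlgCl p)ˣ) : PadicAlgCl p) =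
        (D.aug g) ((ι n t : (PadicAlgCl p)ˣ) : PadicAlgCl p)) :
    Function.Injective ((coh C).toLim ⊤) :=
  toLim_top_injective_of_forall_fixed_eq_one (phi C) (D.lDeltaTheta l) (PiYdd C)
    (hfix_of_tateTwist C ι hpow hcompat hinj hequiv)

/-- **[IUTchII] Prop 2.2 (ii) «respectively» clause, clauses (1)(2), at the model, modulo the Tate twist**
(instead of `hfix`): `∞θ^ι(Π_v)` is nonempty and two members with a common root level differ by a torsion
class — abc-iut-w5-d187's `inftyClause_uniqueness_etaleThetaDataOfSetting'` with `hfix` discharged.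
[claim: Mochizuki2012, status: disputed] (IUTchII §2 Prop 2.2 (ii), kurims p.66) -/
theorem inftyClause_uniqueness_of_tateTwist (hC : D.Compat) (hS : D.Sec2Hyps)
    (hchar : PiYddCharacteristic C) (S : BadPlaceSetting.{0}) (eS : (Pi C) ≃ₜ* S.PiX) (hl : S.l = l)
    {T : TemperedCoverings S (Pi C)}
    {Dec : SubgraphDecomposition S T (etaleThetaDataOfSetting' C hC hS hchar S.toThetaSetting eS hl)}
    (Θ : IotaInvariantTheta' Dec)
    (ι : ℕ → (↥D.DeltaTheta →* (PadicAlgCl p)ˣ))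
    (hpow : ∀ n, 0 < n → ∀ t : ↥D.DeltaTheta, (ι n t) ^ n = 1)
    (hcompat : ∀ n m, 0 < n → 0 < m → ∀ t : ↥D.DeltaTheta, (ι (n * m) t) ^ m = ι n t)
    (hinj : ∀ t : ↥D.DeltaTheta, (∀ n, 0 < n → ι n t = 1) → t = 1)
    (hequiv : ∀ n, 0 < n → ∀ (g : D.PiTemp) (t : ↥D.DeltaTheta),
      ((ι n (MulAut.conjNormal (D.toTheta g) t) : (PadicAlgCl p)ˣ) : PadicAlgCl p) =
        (D.aug g) ((ι n t : (PadicAlgCl p)ˣ) : PadicAlgCl p)) :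
    Θ.thetaInftyIota.Nonempty ∧
      ∀ x ∈ Θ.thetaInftyIota, ∀ x' ∈ Θ.thetaInftyIota,
        (etaleThetaDataOfSetting' C hC hS hchar S.toThetaSetting eS hl).SameRootLevel x x' →
          IsOfFinAddOrder (x - x') :=
  inftyClause_uniqueness_etaleThetaDataOfSetting' C hC hS hchar S eS hl Θ
    (hfix_of_tateTwist C ι hpow hcompat hinj hequiv)

/-- **[IUTchII] Prop 2.2 (ii) «respectively» clause IN FULL at the model, modulo the Tate twist and
(hdiv)** the divisibility of the theta classes in the limit (L2 input, by name) — abc-iut-w5-d187's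
`inftyClause_etaleThetaDataOfSetting'` with `hfix` discharged.
[claim: Mochizuki2012, status: disputed] (IUTchII §2 Prop 2.2 (ii), kurims p.66) -/
theorem inftyClause_of_tateTwist (hC : D.Compat) (hS : D.Sec2Hyps)
    (hchar : PiYddCharacteristic C) (S : BadPlaceSetting.{0}) (eS : (Pi C) ≃ₜ* S.PiX) (hl : S.l = l)
    {T : TemperedCoverings S (Pi C)}
    {Dec : SubgraphDecomposition S T (etaleThetaDataOfSetting' C hC hS hchar S.toThetaSetting eS hl)}
    (Θ : IotaInvariantTheta' Dec)
    (ι : ℕ → (↥D.DeltaTheta →* (PadicAlgCl p)ˣ))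
    (hpow : ∀ n, 0 < n → ∀ t : ↥D.DeltaTheta, (ι n t) ^ n = 1)
    (hcompat : ∀ n m, 0 < n → 0 < m → ∀ t : ↥D.DeltaTheta, (ι (n * m) t) ^ m = ι n t)
    (hinj : ∀ t : ↥D.DeltaTheta, (∀ n, 0 < n → ι n t = 1) → t = 1)
    (hequiv : ∀ n, 0 < n → ∀ (g : D.PiTemp) (t : ↥D.DeltaTheta),
      ((ι n (MulAut.conjNormal (D.toTheta g) t) : (PadicAlgCl p)ˣ) : PadicAlgCl p) =
        (D.aug g) ((ι n t : (PadicAlgCl p)ˣ) : PadicAlgCl p))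
    (hdiv : ∀ t ∈ (etaleThetaDataOfSetting' C hC hS hchar S.toThetaSetting eS hl).theta, ∀ N : ℕ, 0 < N →
      ∃ x : (coh C).lim, N • x = (coh C).toLim ⊤ t) :
    Θ.InftyClause :=
  inftyClause_etaleThetaDataOfSetting' C hC hS hchar S eS hl Θ
    (hfix_of_tateTwist C ι hpow hcompat hinj hequiv) hdiv

end EtaleThetaDataOfSetting

end Literature.IUT.HodgeArakelov
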